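import Literature.MathematicalPhysics.QuantumFieldTheory.Balaban1983to89.B7Eq123General

/-!
# `Balaban1983to89.B7Prop7OneStep` — T. Bałaban, *Averaging operations for lattice gauge theories*, Commun. Math. Phys. **98**
(1985) 17–51 [Balaban1985Averaging]: PROPOSITION 7 (p. 43), THE ONE-STEP CONTENT — the covariant averaging objects and the
one-step map `Q(V′V₀, A)` AT A COMPLEX PERTURBATION `V′V₀` OF A REGULAR BACKGROUND `V₀`: reduction to `V₀`-level objects,
«|Y_x| = O(L²α₀ + Lα₁)», the domain of the series logarithm, and (123) uniformly in `V′` («Proposition 3 holds uniformly for V′V₀»)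

statement-level skeleton of published theorems with citation tags; proofs where landed; nothing here is a claim about the Yang–Mills mass gap

PDF held: `paper:balaban1985-cmp98-averaging` (journal page = PDF page + 16); p. 43 read on the render
`b2b-balaban-ref1/pages/1985-cmp98-averaging/1985-cmp98-averaging-p027-x2.png` (AS AN IMAGE, this unit, 2026-08-21); pp. 27–36 through
the lineage's quotations (`B7Eq92Concrete`, `B7Prop3GeneralAnalytic`, `B7Eq123General`).

CITATION HEADER (lean-in-tree rule).  Cell `lit-balaban` (HOME `run/shared/lean/pub/lit-balaban/`), unit `lit-balaban-r04` (B7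
reader/typer = block owner, gen 4; TAKING line HOME/STATUS.md 2026-08-21T04:30:51Z) — KERNEL PIECES for SKELETON row **`B7.Prop7`**
(typed as the citation statement `B7.Prop7Printed`, no kernel proof before this file).

PRINT (p. 43 [PDF 27], verbatim).  «Another analyticity result we will need is an analyticity of Q_k(U₀, ηA) with respect to U₀.
We will understand it in a similar way as for Ūᵏ. We take U′U₀ instead of U₀, U′ = e^{iηA′}, |A′| < α₁, and we consider the
function Q_k(U′U₀, ηA). We want to prove that it is an analytic function of both variables A′ and A, and that Proposition 4
holds uniformly with respect to A′.  Let us analyze the proof of Proposition 3 first. The bounds depend on bounds of the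
quantities Y_x = (1/i) log V₀(Γ_{c,x} ∪ (−c)). Previously we had |Y_x| = O(L²α₀), but now we allow complex perturbations V′V₀
of V₀, and for these we have |Y_x| = O(L²α₀ + Lα₁). Thus Proposition 3 holds unifirmly [sic] for V′V₀ instead of V₀ and with
the only change in the inequality (126), where the constant e^{O(1)L²α₀} on the right-hand side is replaced by
e^{O(1)(L²α₀+Lα₁)}. Similarly we repeat the reasoning connected with Proposition 4, but with Ū₀ʲ replaced by \overline{U′U₀}ʲ =
Ũ′ʲŪ₀ʲ. Because of the bound (164), we have to replace the factors e^{O(1)L^{2(j+1)}η²α₀} by e^{O(1)(L^{2(j+1)}η²α₀ + L^{j+1}ηα₁)},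
but this change is easily incorporated into the considerations and the estimates. We get the same results as before for α₀,
α₁ sufficiently small, uniformly in A′, and additionally, we get the analyticity of Q_k with respect to A′. Let us formulate
these results in  **Proposition 7.** For U₀ satisfying (52) and U′ = e^{iηA′}, |A′| < α₁, α₀, α₁ sufficiently small, the
function Q_k(U′U₀, ηA) is analytic in complex variables A′, A, and Proposition 4 holds uniformly in A′.»

WHAT THIS FILE PROVES (kernel, no `sorry`, standard axioms; theorems only, no new definition).  The ONE-STEP map (121)
`Q(W, A, c) = log W̿₁(c)` (`B7Prop3GeneralLinear.Qcov L W A`) and its ingredients (58)/(82)/(65)/(89) (`B7Eq92Concrete.tHol /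
wframe / tild / dbavgCov`) AT THE COMPLEX BACKGROUND `W = U″·V₀` — `V₀` a unit-bounded (`U1`) background with regular block loops,
`U″` ANY unit-valued configuration close to `1` (print's `V′ = e^{iηA′}`; the case `U″ = expCfg A″` is the displayed one):
* §1 ALGEBRA (hypothesis-free, every group): the complex-background objects ARE `V₀`-level objects at the fields `YU″` and `U″` —
  `tHol_mul_background` `(R^{U″V₀}_{0,y}Y)(Γ) = (R^{V₀}_{0,y}(YU″))(Γ)·((R^{V₀}_{0,y}U″)(Γ))⁻¹`, `bavg_mul_background` `\overline{U″V₀} = Ũ″·V̄₀`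
  (= (65)), `tild_mul_background`, `Fcov_mul_background`, `dbavgCov_mul_background`; and print's «Ū₀ʲ replaced by \overline{U′U₀}ʲ =
  Ũ′ʲŪ₀ʲ»: `avgIter_mul_background` (= `B7Eq92Concrete.tildIter_mul` (69)) and `logCovIter_succ_mul_background` (the `(j+1)`-st
  factor of the composite (127) `Q_k(U′U₀, ·)` is the one-step map at the complex background `Ũ′ʲ·Ū₀ʲ`).
* §2 «|Y_x| = O(L²α₀ + Lα₁)» — the census item (b) of `B7.Prop7Printed` («|R(W)A| ≤ |W||W⁻¹||A|») made quantitative: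
  `norm_tHol_sub_one_le_general` (background bonds of norm `≤ M`, field within `ε` of `1` ⇒ `‖(R_{0,y}V₁)(Γ) − 1‖ ≤ (M²(1+ε))^{|Γ|} − 1`),
  `norm_tHol_cplx_expCfg_sub_one_le` (`≤ e^{|Γ|(a + 2u)} − 1` at `W = U″V₀`, `‖U″ − 1‖, ‖U″⁻¹ − 1‖ ≤ u`, `|A| ≤ a`), `norm_tHol_pert_sub_one_le`
  (the `V₀`-transports of `U″`), `norm_hol_le_pow` / `norm_bond_cplx_le` (`‖W(Γ)‖, ‖W(Γ)⁻¹‖ ≤ (1+u)^{|Γ|}`).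
* §3 `logDomainCplx` / `logDomainCplx_lt` / `norm_Qcov_cplx_le` — THE DOMAIN CONDITIONS AND THE SUP BOUND at the complex
  background (twin of `B7Prop3GeneralAnalytic.logDomainCov`): `(2d+2)L·(a + 2u) ≤ θ ≤ 1/128`, block loops of `V₀` within `1/128` ⇒
  the block loops of `W` (within `1/32`) and of `e^{A}W` (`1/16`), the twisted tree holonomies (`1/64`) are in the domain of the series
  logarithm (21), `‖W̿₁(c) − 1‖ ≤ 7/10`, `‖Q(W, A, c)‖ ≤ 4`.
* §4 `Qcov_cplx_analyticAt_field` — analyticity of `t ↦ Q(U″V₀, B(t), c)` in the FIELD at a fixed complex background; and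
  **`norm_Ccov_cplx_le`** / `_explicit` / `_of_pdev` — «PROPOSITION 3 HOLDS UNIFORMLY FOR V′V₀ INSTEAD OF V₀», the remainder (123):
  `‖C(U″V₀, A, c)‖ ≤ (8/c₇²)·a² = 2097152(d+1)²L²·a²` for `sup|A_b| ≤ a ≤ c₇(d,L) := c₃(d,L)/4`, with a constant INDEPENDENT of `U″`
  (print's C₁ ↦ 16C₁ of `B7Eq123General`; same Cauchy route as p06's `norm_Ccov_le`).  [v1.1: header constants aligned with the kernel
  statements `norm_Ccov_cplx_le` / `norm_Ccov_cplx_le_explicit` (`a ≤ c3 d L / 4`, `2097152(d+1)²L²`) per referee ref-1 gen 13 F-doc note; no declaration changed.]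
  Also `norm_linQcov_cplx_le_crude` / `norm_Qcov_cplx_le_crude_explicit`: CRUDE (Cauchy) first-order bounds `‖L(Q(U″V₀)A)_c‖ ≤ 2048(d+1)L·a`,
  `‖Q(U″V₀, A, c)‖ ≤ 6144(d+1)L·a`, uniform in `U″` (NOT print's sharp (126), whose complex-background form is the sequel's).
* The JOINT analyticity «in both variables A′ and A» of the one-step map is the companion `B7Prop7OneStepAnalytic` (imports this file).
NOT CLAIMED HERE (row stays `typed-existing`, located): the `k`-LEVEL INDUCTION — (126) at the complex background with leading
coefficient `L(1 + O(L²α₀ + Lα₁))` (print's modification of `B7Prop3GeneralLinearBound`) and hence Proposition 4's (130)/(131) for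
`Q_k(U′U₀, ·)` uniformly in `A′` with print's growth `2Lʲηα₁`, the `k`-fold joint analyticity; the Prop. 5 extension.  §1's
`logCovIter_succ_mul_background` + §3–§4 (+ the companion's joint analyticity) are the one-step inputs of that induction (sequel `B7Prop7Levels`).
READINGS (as in the lineage): `U1`/Banach-algebra carrier, `ℤᵈ` levels, `η` and `i` absorbed, global sup bounds; `log` = the series (21).
REUSED BY NAME: `B7Eq92Concrete.tHol / tHol_cons / Fcov / wframe / tild / tild_apply / dbavgCov / dbavgCov_apply / Rc / tildIter_mul /
avgIter`, `B7Prop3GeneralAnalytic.analyticAt_mlog_dbavgCov_expCfg / norm_tHol_expCfg_sub_one_le / Wcx_mul_eq_tHol_mul / tild_eq_exp_tHol_exp /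
norm_Xavg_le_of_Wcx / norm_Fcov_le_of_tHol`, `B7Prop3GeneralLinear.Qcov / linQcov / Ccov / Qcov_zero`, `B7Prop1Explicit.hol / Wcx / Xavg / bavg /
U1 / expUnit / norm_avg_le / exp_sub_one_le_of_le / norm_exp_sub_one_le_of_norm_le`, `B7Prop2Explicit.pdev`, `B7Eq123General.blockLoops_of_pdev`,
`B7Prop3Flat.expCfg / c3`, `B7Prop4GeneralLevels.logCovIter`, `MatrixLog.mlog / norm_mlog_le_div`.
Unit `lit-balaban-r04` (gen 4), 2026-08-21.

[cite: Balaban1985Averaging, Proposition 7 p.43]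
-/

noncomputable section

open scoped BigOperators
open NormedSpace Metric Set Finset

namespace Literature.MathematicalPhysics.QuantumFieldTheory.Balaban1983to89.B7Prop7OneStep

open B7Prop1Explicit B7Prop2Explicit B7Prop3Flat B7Eq92Concrete MatrixLog B7Prop3GeneralAnalytic B7Prop3GeneralLinear
  B7Prop4GeneralLevels B7Eq123General

-- `Site` alone would resolve to the torus sites of `Setup.lean`; re-export the `ℤ^d` sites of `B7Prop1Explicit`.
export B7Prop1Explicit (Site)

variable {d : ℕ}

/-! ## §0 [folklore] elementary norm bookkeeping -/

section Folklore

variable {𝔸 : Type*} [NormedRing 𝔸]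

omit [NormedRing 𝔸] in
/-- `|XY − 1| ≤ x + y + xy` when `|X − 1| ≤ x`, `|Y − 1| ≤ y`. [folklore] -/
private theorem norm_mul_sub_one_le [NormedRing 𝔸] {X Y : 𝔸} {x y : ℝ} (hX : ‖X - 1‖ ≤ x) (hY : ‖Y - 1‖ ≤ y)
    (hx : 0 ≤ x) : ‖X * Y - 1‖ ≤ x + y + x * y := by
  have h : X * Y - 1 = (X - 1) * (Y - 1) + (X - 1) + (Y - 1) := by noncomm_ring
  rw [h]
  calc ‖(X - 1) * (Y - 1) + (X - 1) + (Y - 1)‖ ≤ ‖(X - 1) * (Y - 1)‖ + ‖X - 1‖ + ‖Y - 1‖ := norm_add₃_le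
    _ ≤ ‖X - 1‖ * ‖Y - 1‖ + ‖X - 1‖ + ‖Y - 1‖ := by gcongr; exact norm_mul_le _ _
    _ ≤ x * y + x + y := by gcongr
    _ = x + y + x * y := by ring

/-- `|X| ≤ 1 + |X − 1|`. [folklore] -/
private theorem norm_le_one_add_norm_sub_one [NormOneClass 𝔸] (X : 𝔸) : ‖X‖ ≤ 1 + ‖X - 1‖ := by
  have h := norm_add_le (X - 1) (1 : 𝔸)
  rw [sub_add_cancel, norm_one] at h
  linarith

/-- `|XZX⁻¹ − 1| ≤ |X|·|Z − 1|·|X⁻¹|` — print's modification (b) «|R(W)A| ≤ |W||W⁻¹||A|» for the non-unitary transports.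
[cite: Balaban1985Averaging, Proposition 7 p.43] -/
theorem norm_units_conj_sub_one_le_mul (X : 𝔸ˣ) (Z : 𝔸) :
    ‖(X : 𝔸) * Z * ((X⁻¹ : 𝔸ˣ) : 𝔸) - 1‖ ≤ ‖(X : 𝔸)‖ * ‖Z - 1‖ * ‖((X⁻¹ : 𝔸ˣ) : 𝔸)‖ := by
  have h : (X : 𝔸) * Z * ((X⁻¹ : 𝔸ˣ) : 𝔸) - 1 = (X : 𝔸) * (Z - 1) * ((X⁻¹ : 𝔸ˣ) : 𝔸) := by
    rw [mul_sub, sub_mul, mul_one, Units.mul_inv]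
  rw [h]
  exact (norm_mul_le _ _).trans (mul_le_mul_of_nonneg_right (norm_mul_le _ _) (norm_nonneg _))

/-- `|X⁻¹ZX − 1| ≤ |X⁻¹|·|Z − 1|·|X|`. [cite: Balaban1985Averaging, Proposition 7 p.43] -/
theorem norm_units_inv_conj_sub_one_le_mul (X : 𝔸ˣ) (Z : 𝔸) :
    ‖((X⁻¹ : 𝔸ˣ) : 𝔸) * Z * (X : 𝔸) - 1‖ ≤ ‖((X⁻¹ : 𝔸ˣ) : 𝔸)‖ * ‖Z - 1‖ * ‖(X : 𝔸)‖ := by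
  have := norm_units_conj_sub_one_le_mul X⁻¹ Z
  rwa [inv_inv] at this

end Folklore

/-! ## §1 ALGEBRA: the objects at the complex background `U″·V₀` are `V₀`-level objects at the fields `YU″` and `U″` -/

section Algebra

variable {G : Type*} [Group G]

/-- **the twisted holonomy (58) at the complex background**: `(R^{U″V₀}_{0,y}Y)(Γ) = (YU″V₀)(Γ)·(U″V₀)(Γ)⁻¹ =
[(YU″V₀)(Γ)V₀(Γ)⁻¹]·[(U″V₀)(Γ)V₀(Γ)⁻¹]⁻¹ = (R^{V₀}_{0,y}(YU″))(Γ)·((R^{V₀}_{0,y}U″)(Γ))⁻¹` — the mechanism behind print's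
«now we allow complex perturbations V′V₀ of V₀» (every complex-background transport is a quotient of two `V₀`-transports of
small fields). [cite: Balaban1985Averaging, Proposition 7 p.43, (58) p.27] -/
theorem tHol_mul_background (V₀ U'' Y : Site d → Fin d → G) (y : Site d) (w : List (Letter d)) :
    tHol (U'' * V₀) Y y w = tHol V₀ (Y * U'') y w * (tHol V₀ U'' y w)⁻¹ := by
  simp only [tHol, mul_assoc Y U'' V₀]
  group

end Algebra

section AlgebraUnits

variable {𝔸 : Type*} [NormedRing 𝔸] [NormedAlgebra ℂ 𝔸] [CompleteSpace 𝔸]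
variable (L : ℕ)

/-- **(65) read at the complex background: `\overline{U″V₀}(c) = Ũ″(c)·V̄₀(c)`** (`Ũ″ = tild L V₀ U″`) — print's «\overline{U′U₀}ʲ
= Ũ′ʲŪ₀ʲ» for one step. [cite: Balaban1985Averaging, Proposition 7 p.43, (65) p.29] -/
theorem bavg_mul_background (V₀ U'' : Site d → Fin d → 𝔸ˣ) (q : Site d) (κ : Fin d) :
    bavg L (U'' * V₀) q κ = tild L V₀ U'' q κ * bavg L V₀ q κ := by
  rw [tild_apply, inv_mul_cancel_right]

/-- **(65) at the complex background**: `Ỹ^{U″V₀}(c) = \overline{YU″V₀}(c)·\overline{U″V₀}(c)⁻¹ = \widetilde{YU″}^{V₀}(c)·(Ũ″^{V₀}(c))⁻¹`.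
[cite: Balaban1985Averaging, Proposition 7 p.43, (65) p.29] -/
theorem tild_mul_background (V₀ U'' Y : Site d → Fin d → 𝔸ˣ) (q : Site d) (κ : Fin d) :
    tild L (U'' * V₀) Y q κ = tild L V₀ (Y * U'') q κ * (tild L V₀ U'' q κ)⁻¹ := by
  simp only [tild_apply, mul_assoc Y U'' V₀]
  group

omit [CompleteSpace 𝔸] in
/-- **the frame exponent (62)/(82) at the complex background** through `V₀`-transports:
`F^{U″V₀}(y)[Y] = Σ_{x∈B(y)} L^{−d} log[(R^{V₀}_{0,y}(YU″))(Γ_{y,x})·((R^{V₀}_{0,y}U″)(Γ_{y,x}))⁻¹]`. [cite: Balaban1985Averaging, Proposition 7 p.43, (82) p.30] -/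
theorem Fcov_mul_background (V₀ U'' Y : Site d → Fin d → 𝔸ˣ) (y : Site d) :
    Fcov L (U'' * V₀) Y y = ∑ r : Fin d → Fin L, (((L : ℝ) ^ d)⁻¹) •
      mlog (((tHol V₀ (Y * U'') y (treeWord (boxVec L r)) * (tHol V₀ U'' y (treeWord (boxVec L r)))⁻¹ : 𝔸ˣ) : 𝔸)) := by
  simp only [Fcov, tHol_mul_background]

/-- **(89) AT THE COMPLEX BACKGROUND**: `Y̿^{U″V₀}(c) = F(c₋)⁻¹ · \widetilde{YU″}^{V₀}(c) · R̄^{V₀}_{0,c}F(c₊) · (Ũ″^{V₀}(c))⁻¹`,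
`F = \overline{R^{U″V₀}_{0,·}Y}` the frame at the complex background — the rotation `R̄^{U″V₀}_{0,c} = R(Ũ″(c)V̄₀(c))` factors through
`R(Ũ″(c))`, which cancels against the `Ũ″(c)⁻¹` of (65). [cite: Balaban1985Averaging, Proposition 7 p.43, (89) p.31] -/
theorem dbavgCov_mul_background (V₀ U'' Y : Site d → Fin d → 𝔸ˣ) (q : Site d) (κ : Fin d) :
    dbavgCov L (U'' * V₀) Y q κ
      = (wframe L (U'' * V₀) Y q)⁻¹ * tild L V₀ (Y * U'') q κ
          * Rc (bavg L V₀ q κ) (wframe L (U'' * V₀) Y (q + (L : ℤ) • e κ)) * (tild L V₀ U'' q κ)⁻¹ := by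
  rw [dbavgCov_apply, tild_mul_background, bavg_mul_background]
  simp only [Rc_apply]
  group

/-- **print's «Ū₀ʲ replaced by \overline{U′U₀}ʲ = Ũ′ʲŪ₀ʲ»**: the level backgrounds of `U′U₀` are the complex perturbations `Ũ′ʲ =
tildIter L U₀ U′ j` (69) of the regular unitary `Ū₀ʲ = avgIter L U₀ j` (`B7Eq92Concrete.tildIter_mul`, hypothesis-free).
[cite: Balaban1985Averaging, Proposition 7 p.43, (69) p.29] -/
theorem avgIter_mul_background (U₀ U' : Site d → Fin d → 𝔸ˣ) (j : ℕ) :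
    avgIter L (U' * U₀) j = tildIter L U₀ U' j * avgIter L U₀ j :=
  (tildIter_mul L U₀ U' j).symm

/-- **«we repeat the reasoning connected with Proposition 4, but with Ū₀ʲ replaced by \overline{U′U₀}ʲ = Ũ′ʲŪ₀ʲ»**: the `(j+1)`-st
factor of the composite (127) `Q_k(U′U₀, ·)` (`B7Prop4GeneralLevels.logCovIter L (U′U₀)`) IS the one-step map (121) at the complex
background `Ũ′ʲ·Ū₀ʲ`. [cite: Balaban1985Averaging, Proposition 7 p.43, (127) p.37] -/
theorem logCovIter_succ_mul_background (U₀ U' : Site d → Fin d → 𝔸ˣ) (B : Site d → Fin d → 𝔸) (j : ℕ) (z : Site d)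
    (κ : Fin d) :
    logCovIter L (U' * U₀) B (j + 1) z κ
      = Qcov L (tildIter L U₀ U' j * avgIter L U₀ j) (logCovIter L (U' * U₀) B j) ((L : ℤ) • z) κ := by
  rw [logCovIter_succ, tildIter_mul]

end AlgebraUnits

/-! ## §2 «|Y_x| = O(L²α₀ + Lα₁)»: the transports and block loops at the complex background -/

section Transports

variable {𝔸 : Type*} [NormedRing 𝔸] [NormedAlgebra ℂ 𝔸] [CompleteSpace 𝔸] [NormOneClass 𝔸]

omit [NormedAlgebra ℂ 𝔸] [CompleteSpace 𝔸] [NormOneClass 𝔸] in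
/-- **census item (b), quantified**: for a background `W` whose bond variables and their inverses have norm `≤ M` (`M ≥ 1`; `M = 1`
for `W ∈ U1`, e.g. unitary) and a field `V₁` within `ε` of `1` bondwise (together with its inverses), the twisted holonomy (58)
satisfies `‖(R^{W}_{0,y}V₁)(Γ) − 1‖ ≤ (M²(1+ε))^{|Γ|} − 1` — each bond of `Γ` contributes a factor `V₁(b)^{±1}` and a conjugation by
`W(b)^{±1}`, «|R(W)A| ≤ |W||W⁻¹||A|». [cite: Balaban1985Averaging, Proposition 7 p.43, (58) p.27] -/
theorem norm_tHol_sub_one_le_general {W V₁ : Site d → Fin d → 𝔸ˣ} {M ε : ℝ} (hM : 1 ≤ M) (hε : 0 ≤ ε)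
    (hW : ∀ x κ, ‖((W x κ : 𝔸ˣ) : 𝔸)‖ ≤ M ∧ ‖(((W x κ)⁻¹ : 𝔸ˣ) : 𝔸)‖ ≤ M)
    (hV : ∀ x κ, ‖((V₁ x κ : 𝔸ˣ) : 𝔸) - 1‖ ≤ ε ∧ ‖(((V₁ x κ)⁻¹ : 𝔸ˣ) : 𝔸) - 1‖ ≤ ε) :
    ∀ (w : List (Letter d)) (y : Site d),
      ‖((tHol W V₁ y w : 𝔸ˣ) : 𝔸) - 1‖ ≤ (M ^ 2 * (1 + ε)) ^ w.length - 1
  | [], y => by simp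
  | (μ, true) :: w, y => by
      have ih := norm_tHol_sub_one_le_general hM hε hW hV w (y + e μ)
      set T : 𝔸 := ((tHol W V₁ (y + e μ) w : 𝔸ˣ) : 𝔸) with hT
      set K : ℝ := M ^ 2 * (1 + ε) with hK
      have hK1 : 1 ≤ K := by rw [hK]; nlinarith
      have hKn : 0 ≤ K ^ w.length - 1 := by
        have := one_le_pow₀ (n := w.length) hK1; linarith
      have hval : ((tHol W V₁ y ((μ, true) :: w) : 𝔸ˣ) : 𝔸)
          = ((V₁ y μ : 𝔸ˣ) : 𝔸) * (((W y μ : 𝔸ˣ) : 𝔸) * T * (((W y μ)⁻¹ : 𝔸ˣ) : 𝔸)) := by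
        rw [tHol_cons]
        simp only [stepHol_true, Pi.mul_apply, Letter.vec_true, Units.val_mul, mul_assoc, hT]
      have h2 : ‖((W y μ : 𝔸ˣ) : 𝔸) * T * (((W y μ)⁻¹ : 𝔸ˣ) : 𝔸) - 1‖ ≤ M ^ 2 * (K ^ w.length - 1) := by
        refine (norm_units_conj_sub_one_le_mul (W y μ) T).trans ?_
        have h := mul_le_mul (mul_le_mul (hW y μ).1 ih (norm_nonneg _) (by linarith)) (hW y μ).2 (norm_nonneg _)
          (mul_nonneg (by linarith) hKn)
        refine h.trans (le_of_eq ?_); ring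
      rw [hval, List.length_cons, pow_succ]
      refine (norm_mul_sub_one_le (hV y μ).1 h2 hε).trans ?_
      have hM2 : 1 ≤ M ^ 2 := by nlinarith
      nlinarith [mul_nonneg (sub_nonneg.2 hM2) hε, one_le_pow₀ (n := w.length) hK1]
  | (μ, false) :: w, y => by
      have ih := norm_tHol_sub_one_le_general hM hε hW hV w (y + -e μ)
      set T : 𝔸 := ((tHol W V₁ (y + -e μ) w : 𝔸ˣ) : 𝔸) with hT
      set K : ℝ := M ^ 2 * (1 + ε) with hK
      have hK1 : 1 ≤ K := by rw [hK]; nlinarith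
      have hKn : 0 ≤ K ^ w.length - 1 := by
        have := one_le_pow₀ (n := w.length) hK1; linarith
      have hval : ((tHol W V₁ y ((μ, false) :: w) : 𝔸ˣ) : 𝔸)
          = (((W (y - e μ) μ)⁻¹ : 𝔸ˣ) : 𝔸) * ((((V₁ (y - e μ) μ)⁻¹ : 𝔸ˣ) : 𝔸) * T) * ((W (y - e μ) μ : 𝔸ˣ) : 𝔸) := by
        rw [tHol_cons]
        simp only [stepHol_false, Pi.mul_apply, Letter.vec_false, mul_inv_rev, inv_inv, Units.val_mul, mul_assoc, hT]
      have h1 : ‖(((V₁ (y - e μ) μ)⁻¹ : 𝔸ˣ) : 𝔸) * T - 1‖ ≤ ε + (K ^ w.length - 1) + ε * (K ^ w.length - 1) :=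
        norm_mul_sub_one_le (hV _ μ).2 ih hε
      rw [hval, List.length_cons, pow_succ]
      refine (norm_units_inv_conj_sub_one_le_mul (W (y - e μ) μ) _).trans ?_
      have hin : 0 ≤ ε + (K ^ w.length - 1) + ε * (K ^ w.length - 1) := by positivity
      have h := mul_le_mul (mul_le_mul (hW (y - e μ) μ).2 h1 (norm_nonneg _) (by linarith)) (hW (y - e μ) μ).1
        (norm_nonneg _) (mul_nonneg (by linarith) hin)
      refine h.trans ?_
      have hM2 : 1 ≤ M ^ 2 := by nlinarith
      nlinarith [mul_nonneg (sub_nonneg.2 hM2) hε, one_le_pow₀ (n := w.length) hK1]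

omit [NormedAlgebra ℂ 𝔸] [CompleteSpace 𝔸] in
/-- the norms of the transports (9) of a background with bond norms `≤ M`: `‖W(Γ)‖, ‖W(Γ)⁻¹‖ ≤ M^{|Γ|}` — «|W||W⁻¹| ≤ e^{O(1)Lα₁}»
for `|Γ| = O(L)`. [cite: Balaban1985Averaging, Proposition 7 p.43, (9) p.18] -/
theorem norm_hol_le_pow {W : Site d → Fin d → 𝔸ˣ} {M : ℝ} (hM : 0 ≤ M)
    (hW : ∀ x κ, ‖((W x κ : 𝔸ˣ) : 𝔸)‖ ≤ M ∧ ‖(((W x κ)⁻¹ : 𝔸ˣ) : 𝔸)‖ ≤ M) :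
    ∀ (w : List (Letter d)) (y : Site d),
      ‖((hol W y w : 𝔸ˣ) : 𝔸)‖ ≤ M ^ w.length ∧ ‖(((hol W y w)⁻¹ : 𝔸ˣ) : 𝔸)‖ ≤ M ^ w.length
  | [], y => by simp
  | l :: w, y => by
      obtain ⟨ih1, ih2⟩ := norm_hol_le_pow hM hW w (y + l.vec)
      have hs : ‖((stepHol W y l : 𝔸ˣ) : 𝔸)‖ ≤ M ∧ ‖(((stepHol W y l)⁻¹ : 𝔸ˣ) : 𝔸)‖ ≤ M := by
        obtain ⟨μ, b⟩ := l
        cases b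
        · rw [stepHol_false, inv_inv]; exact ⟨(hW _ μ).2, (hW _ μ).1⟩
        · rw [stepHol_true]; exact hW y μ
      refine ⟨?_, ?_⟩
      · rw [hol_cons, Units.val_mul, List.length_cons, pow_succ']
        exact (norm_mul_le _ _).trans (mul_le_mul hs.1 ih1 (norm_nonneg _) hM)
      · rw [hol_cons, mul_inv_rev, Units.val_mul, List.length_cons, pow_succ]
        exact (norm_mul_le _ _).trans (mul_le_mul ih2 hs.2 (norm_nonneg _) (pow_nonneg hM _))

omit [NormedAlgebra ℂ 𝔸] [CompleteSpace 𝔸] in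
/-- the bond variables of the complex background `W = U″V₀` (`V₀ ∈ U1`, `‖U″(b) − 1‖, ‖U″(b)⁻¹ − 1‖ ≤ u`) and their inverses have
norm `≤ 1 + u`. [cite: Balaban1985Averaging, Proposition 7 p.43] -/
theorem norm_bond_cplx_le {V₀ U'' : Site d → Fin d → 𝔸ˣ} (hV₀ : ∀ x κ, V₀ x κ ∈ U1 𝔸) {u : ℝ}
    (hU : ∀ x κ, ‖((U'' x κ : 𝔸ˣ) : 𝔸) - 1‖ ≤ u ∧ ‖(((U'' x κ)⁻¹ : 𝔸ˣ) : 𝔸) - 1‖ ≤ u) (x : Site d) (κ : Fin d) :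
    ‖(((U'' * V₀) x κ : 𝔸ˣ) : 𝔸)‖ ≤ 1 + u ∧ ‖((((U'' * V₀) x κ)⁻¹ : 𝔸ˣ) : 𝔸)‖ ≤ 1 + u := by
  have hu1 : ‖((U'' x κ : 𝔸ˣ) : 𝔸)‖ ≤ 1 + u := (norm_le_one_add_norm_sub_one _).trans (by linarith [(hU x κ).1])
  have hu2 : ‖(((U'' x κ)⁻¹ : 𝔸ˣ) : 𝔸)‖ ≤ 1 + u := (norm_le_one_add_norm_sub_one _).trans (by linarith [(hU x κ).2])
  have hu0 : 0 ≤ 1 + u := (norm_nonneg _).trans hu1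
  refine ⟨?_, ?_⟩
  · simp only [Pi.mul_apply, Units.val_mul]
    exact (norm_mul_le _ _).trans ((mul_le_mul hu1 (hV₀ x κ).1 (norm_nonneg _) hu0).trans (by rw [mul_one]))
  · simp only [Pi.mul_apply, mul_inv_rev, Units.val_mul]
    exact (norm_mul_le _ _).trans ((mul_le_mul (hV₀ x κ).2 hu2 (norm_nonneg _) zero_le_one).trans (by rw [one_mul]))

omit [NormOneClass 𝔸] in
/-- the bond variables of the small field `V₁ = e^{A}` (109), `|A_b| ≤ a`, and their inverses are within `e^{a} − 1` of `1`.
[cite: Balaban1985Averaging, (109) p.34, (24) p.21] -/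
theorem norm_bond_expCfg_sub_one_le (A : Site d → Fin d → 𝔸) {a : ℝ} (hA : ∀ x κ, ‖A x κ‖ ≤ a) (x : Site d) (κ : Fin d) :
    ‖((expCfg A x κ : 𝔸ˣ) : 𝔸) - 1‖ ≤ Real.exp a - 1 ∧ ‖(((expCfg A x κ)⁻¹ : 𝔸ˣ) : 𝔸) - 1‖ ≤ Real.exp a - 1 := by
  refine ⟨?_, ?_⟩
  · rw [expCfg, val_expUnit]; exact (norm_exp_sub_one_le_of_norm_le (hA x κ)).1
  · rw [expCfg, val_inv_expUnit, val_expUnit]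
    exact (norm_exp_sub_one_le_of_norm_le ((norm_neg _).le.trans (hA x κ))).1

/-- **«|Y_x| = O(L²α₀ + Lα₁)», the transport half**: at the complex background `W = U″V₀` (`V₀ ∈ U1`, `‖U″ − 1‖, ‖U″⁻¹ − 1‖ ≤ u`
bondwise) the twisted holonomy of `V₁ = e^{A}`, `|A_b| ≤ a`, satisfies `‖(R^{W}_{0,y}V₁)(Γ) − 1‖ ≤ e^{|Γ|(a + 2u)} − 1` (the `V₀`-case
`u = 0` is `B7Prop3GeneralAnalytic.norm_tHol_expCfg_sub_one_le`). [cite: Balaban1985Averaging, Proposition 7 p.43, (58) p.27] -/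
theorem norm_tHol_cplx_expCfg_sub_one_le {V₀ U'' : Site d → Fin d → 𝔸ˣ} (hV₀ : ∀ x κ, V₀ x κ ∈ U1 𝔸) {u : ℝ} (hu : 0 ≤ u)
    (hU : ∀ x κ, ‖((U'' x κ : 𝔸ˣ) : 𝔸) - 1‖ ≤ u ∧ ‖(((U'' x κ)⁻¹ : 𝔸ˣ) : 𝔸) - 1‖ ≤ u)
    (A : Site d → Fin d → 𝔸) {a : ℝ} (ha : 0 ≤ a) (hA : ∀ x κ, ‖A x κ‖ ≤ a) (w : List (Letter d)) (y : Site d) :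
    ‖((tHol (U'' * V₀) (expCfg A) y w : 𝔸ˣ) : 𝔸) - 1‖ ≤ Real.exp (w.length * (a + 2 * u)) - 1 := by
  have hε : 0 ≤ Real.exp a - 1 := by linarith [Real.add_one_le_exp a]
  have h := norm_tHol_sub_one_le_general (W := U'' * V₀) (V₁ := expCfg A) (M := 1 + u) (ε := Real.exp a - 1)
    (by linarith) hε (norm_bond_cplx_le hV₀ hU) (norm_bond_expCfg_sub_one_le A hA) w y
  refine h.trans (sub_le_sub_right ?_ _)
  have hb : (1 + u) ^ 2 * (1 + (Real.exp a - 1)) ≤ Real.exp (a + 2 * u) := by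
    rw [add_sub_cancel, Real.exp_add, mul_comm]
    refine mul_le_mul_of_nonneg_left ?_ (Real.exp_pos a).le
    calc (1 + u) ^ 2 ≤ Real.exp u ^ 2 :=
          pow_le_pow_left₀ (by linarith) (by linarith [Real.add_one_le_exp u]) 2
      _ = Real.exp (2 * u) := by rw [← Real.exp_nat_mul]; norm_num
  calc ((1 + u) ^ 2 * (1 + (Real.exp a - 1))) ^ w.length ≤ Real.exp (a + 2 * u) ^ w.length :=
        pow_le_pow_left₀ (by positivity) hb _
    _ = Real.exp (w.length * (a + 2 * u)) := by rw [← Real.exp_nat_mul]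

/-- … hence `≤ 2θ` for every contour of length `≤ n` once `n·(a + 2u) ≤ θ ≤ 1/64`. [cite: Balaban1985Averaging, Proposition 7 p.43, (47) p.25] -/
theorem norm_tHol_cplx_expCfg_sub_one_le_of_length {V₀ U'' : Site d → Fin d → 𝔸ˣ} (hV₀ : ∀ x κ, V₀ x κ ∈ U1 𝔸) {u : ℝ}
    (hu : 0 ≤ u) (hU : ∀ x κ, ‖((U'' x κ : 𝔸ˣ) : 𝔸) - 1‖ ≤ u ∧ ‖(((U'' x κ)⁻¹ : 𝔸ˣ) : 𝔸) - 1‖ ≤ u)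
    (A : Site d → Fin d → 𝔸) {a θ : ℝ} (ha : 0 ≤ a) (hA : ∀ x κ, ‖A x κ‖ ≤ a) {n : ℕ} (hθ : (n : ℝ) * (a + 2 * u) ≤ θ)
    (hθ0 : 0 ≤ θ) (hθ1 : θ ≤ 1 / 64) {w : List (Letter d)} (hw : w.length ≤ n) (y : Site d) :
    ‖((tHol (U'' * V₀) (expCfg A) y w : 𝔸ˣ) : 𝔸) - 1‖ ≤ 2 * θ :=
  (norm_tHol_cplx_expCfg_sub_one_le hV₀ hu hU A ha hA w y).trans
    (exp_sub_one_le_of_le ((mul_le_mul_of_nonneg_right (by exact_mod_cast hw) (by positivity)).trans hθ) hθ0 hθ1)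

omit [NormedAlgebra ℂ 𝔸] [CompleteSpace 𝔸] in
/-- **the transports of the perturbation itself**: `‖(R^{V₀}_{0,y}U″)(Γ) − 1‖ ≤ e^{|Γ|u} − 1` (`V₀ ∈ U1`; the case `M = 1` of
`norm_tHol_sub_one_le_general`). [cite: Balaban1985Averaging, Proposition 7 p.43, (58) p.27] -/
theorem norm_tHol_pert_sub_one_le {V₀ U'' : Site d → Fin d → 𝔸ˣ} (hV₀ : ∀ x κ, V₀ x κ ∈ U1 𝔸) {u : ℝ} (hu : 0 ≤ u)
    (hU : ∀ x κ, ‖((U'' x κ : 𝔸ˣ) : 𝔸) - 1‖ ≤ u ∧ ‖(((U'' x κ)⁻¹ : 𝔸ˣ) : 𝔸) - 1‖ ≤ u) (w : List (Letter d)) (y : Site d) :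
    ‖((tHol V₀ U'' y w : 𝔸ˣ) : 𝔸) - 1‖ ≤ Real.exp (w.length * u) - 1 := by
  have h := norm_tHol_sub_one_le_general (W := V₀) (V₁ := U'') (M := 1) (ε := u) le_rfl hu
    (fun x κ => ⟨(hV₀ x κ).1, (hV₀ x κ).2⟩) hU w y
  refine h.trans (sub_le_sub_right ?_ _)
  rw [one_pow, one_mul]
  calc (1 + u) ^ w.length ≤ Real.exp u ^ w.length :=
        pow_le_pow_left₀ (by positivity) (by linarith [Real.add_one_le_exp u]) _
    _ = Real.exp (w.length * u) := by rw [← Real.exp_nat_mul]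

end Transports

/-! ## §3 The domain of the series logarithm and the sup bound at the complex background -/

section Domain

variable {𝔸 : Type*} [NormedRing 𝔸] [NormedAlgebra ℂ 𝔸] [CompleteSpace 𝔸] [NormOneClass 𝔸]

omit [NormOneClass 𝔸] in
/-- `|e^{Y} − 1| ≤ 2|Y|` for `|Y| ≤ 1`. [folklore] -/
private theorem norm_exp_sub_one_le_two_mul {Y : 𝔸} (h : ‖Y‖ ≤ 1) : ‖exp Y - 1‖ ≤ 2 * ‖Y‖ := by
  have h1 := (norm_exp_sub_one_le_of_norm_le (le_refl ‖Y‖)).1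
  have h2 := Real.abs_exp_sub_one_le (x := ‖Y‖) (by rwa [abs_of_nonneg (norm_nonneg _)])
  rw [abs_of_nonneg (norm_nonneg Y)] at h2
  exact h1.trans ((le_abs_self _).trans h2)

/-- **THE DOMAIN CONDITIONS AT THE COMPLEX BACKGROUND** (twin of `B7Prop3GeneralAnalytic.logDomainCov`, print's «Proposition 3 holds …
for V′V₀ instead of V₀»): `V₀` unit-bounded with block loops at the `L`-bond `c = (q, κ)` within `α ≤ 1/128` of `1`, the perturbation
`U″` within `u` of `1` bondwise (with its inverses), the field `V₁ = e^{A}` with `(2d+2)L·(sup|A_b| + 2u) ≤ θ ≤ 1/128` ⟹ at `W = U″V₀`: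
the block loops of `W` are within `1/32` of `1`, those of `V₁W` within `1/16`, the twisted tree holonomies at `c₋`, `c₊` within
`1/64`, and `‖W̿₁(c) − 1‖ ≤ 7/10`. [cite: Balaban1985Averaging, Proposition 7 p.43, (120) p.35] -/
theorem logDomainCplx {L : ℕ} (hL : 1 ≤ L) {V₀ U'' : Site d → Fin d → 𝔸ˣ} (hV₀ : ∀ x κ, V₀ x κ ∈ U1 𝔸) {u : ℝ} (hu : 0 ≤ u)
    (hU : ∀ x κ, ‖((U'' x κ : 𝔸ˣ) : 𝔸) - 1‖ ≤ u ∧ ‖(((U'' x κ)⁻¹ : 𝔸ˣ) : 𝔸) - 1‖ ≤ u)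
    (A : Site d → Fin d → 𝔸) {a θ α : ℝ} (ha : 0 ≤ a) (hA : ∀ x κ, ‖A x κ‖ ≤ a)
    (hθ : ((2 * (d * L) + L + L : ℕ) : ℝ) * (a + 2 * u) ≤ θ) (hθ0 : 0 ≤ θ) (hθ1 : θ ≤ 1 / 128)
    (q : Site d) (κ : Fin d) (hα1 : α ≤ 1 / 128)
    (hreg : ∀ r : Fin d → Fin L, ‖((Wcx L V₀ q κ (boxVec L r) : 𝔸ˣ) : 𝔸) - 1‖ ≤ α) :
    (∀ r : Fin d → Fin L, ‖((Wcx L (U'' * V₀) q κ (boxVec L r) : 𝔸ˣ) : 𝔸) - 1‖ ≤ 1 / 32) ∧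
    (∀ r : Fin d → Fin L, ‖((Wcx L (expCfg A * (U'' * V₀)) q κ (boxVec L r) : 𝔸ˣ) : 𝔸) - 1‖ ≤ 1 / 16) ∧
    (∀ r : Fin d → Fin L, ‖((tHol (U'' * V₀) (expCfg A) q (treeWord (boxVec L r)) : 𝔸ˣ) : 𝔸) - 1‖ ≤ 1 / 64) ∧
    (∀ r : Fin d → Fin L,
      ‖((tHol (U'' * V₀) (expCfg A) (q + (L : ℤ) • e κ) (treeWord (boxVec L r)) : 𝔸ˣ) : 𝔸) - 1‖ ≤ 1 / 64) ∧
    ‖((dbavgCov L (U'' * V₀) (expCfg A) q κ : 𝔸ˣ) : 𝔸) - 1‖ ≤ 7 / 10 := by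
  set W : Site d → Fin d → 𝔸ˣ := U'' * V₀ with hWdef
  have hn0 : (0 : ℝ) ≤ ((2 * (d * L) + L + L : ℕ) : ℝ) := by positivity
  have hθu : ((2 * (d * L) + L + L : ℕ) : ℝ) * u ≤ θ / 2 := by nlinarith
  -- the transports of `V₁ = e^{A}` at `W`: lengths `≤ (2d+2)L` give `≤ 2θ ≤ 1/64`
  have hτ : ∀ (w : List (Letter d)) (y : Site d), w.length ≤ 2 * (d * L) + L + L →
      ‖((tHol W (expCfg A) y w : 𝔸ˣ) : 𝔸) - 1‖ ≤ 1 / 64 := fun w y hw =>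
    (norm_tHol_cplx_expCfg_sub_one_le_of_length hV₀ hu hU A ha hA hθ hθ0 (by linarith) hw y).trans (by linarith)
  -- the transports of the perturbation `U″` at `V₀`: `≤ θ ≤ 1/128`
  have hτ'' : ∀ (w : List (Letter d)) (y : Site d), w.length ≤ 2 * (d * L) + L + L →
      ‖((tHol V₀ U'' y w : 𝔸ˣ) : 𝔸) - 1‖ ≤ 1 / 128 := fun w y hw => by
    refine (norm_tHol_pert_sub_one_le hV₀ hu hU w y).trans ?_
    have hs : (w.length : ℝ) * u ≤ θ / 2 :=
      (mul_le_mul_of_nonneg_right (by exact_mod_cast hw) hu).trans hθu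
    have := exp_sub_one_le_of_le hs (by linarith) (by linarith)
    linarith
  have htree : ∀ r : Fin d → Fin L, (treeWord (boxVec L r)).length ≤ 2 * (d * L) + L + L := fun r => by
    rw [length_treeWord]; have := l1_boxVec_le (L := L) r; omega
  have hloop : ∀ r : Fin d → Fin L,
      (gammaWord L κ (boxVec L r) ++ seg κ (-(L : ℤ))).length ≤ 2 * (d * L) + L + L := fun r => by
    rw [List.length_append, length_gammaWord, length_seg, Int.natAbs_neg, Int.natAbs_natCast]
    have := l1_boxVec_le (L := L) r; omega
  have hseg : (seg κ (L : ℤ) : List (Letter d)).length ≤ 2 * (d * L) + L + L := by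
    rw [length_seg, Int.natAbs_natCast]; omega
  have hT₁ : ∀ r : Fin d → Fin L,
      ‖((tHol W (expCfg A) q (treeWord (boxVec L r)) : 𝔸ˣ) : 𝔸) - 1‖ ≤ 1 / 64 := fun r => hτ _ _ (htree r)
  have hT₂ : ∀ r : Fin d → Fin L,
      ‖((tHol W (expCfg A) (q + (L : ℤ) • e κ) (treeWord (boxVec L r)) : 𝔸ˣ) : 𝔸) - 1‖ ≤ 1 / 64 :=
    fun r => hτ _ _ (htree r)
  -- block loops of the background `W = U″V₀`: `(1 + 1/128)(1 + α) − 1 ≤ 1/32`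
  have hWb : ∀ r : Fin d → Fin L, ‖((Wcx L W q κ (boxVec L r) : 𝔸ˣ) : 𝔸) - 1‖ ≤ 1 / 32 := by
    intro r
    rw [hWdef, Wcx_mul_eq_tHol_mul, Units.val_mul]
    refine (norm_mul_sub_one_le (hτ'' _ _ (hloop r)) (hreg r) (by norm_num)).trans ?_
    nlinarith [(norm_nonneg _).trans (hreg r)]
  -- block loops of `V₁W`: `(1 + 1/64)(1 + 1/32) − 1 ≤ 1/16`
  have hW : ∀ r : Fin d → Fin L, ‖((Wcx L (expCfg A * W) q κ (boxVec L r) : 𝔸ˣ) : 𝔸) - 1‖ ≤ 1 / 16 := by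
    intro r
    rw [Wcx_mul_eq_tHol_mul, Units.val_mul]
    refine (norm_mul_sub_one_le (hτ _ _ (hloop r)) (hWb r) (by norm_num)).trans ?_
    norm_num
  refine ⟨hWb, hW, hT₁, hT₂, ?_⟩
  -- the exponents `X_c(V₁W)`, `X_c(W)` and the frames
  have hX' : ‖Xavg L (expCfg A * W) q κ‖ ≤ 1 / 8 :=
    (norm_Xavg_le_of_Wcx hL _ q κ hW (by norm_num)).trans (by norm_num)
  have hX₀ : ‖Xavg L W q κ‖ ≤ 1 / 16 := (norm_Xavg_le_of_Wcx hL _ q κ hWb (by norm_num)).trans (by norm_num)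
  have hE' : ‖exp (Xavg L (expCfg A * W) q κ) - 1‖ ≤ 1 / 4 :=
    (norm_exp_sub_one_le_two_mul (hX'.trans (by norm_num))).trans (by linarith)
  have hE₀ : ‖exp (Xavg L W q κ) - 1‖ ≤ 1 / 8 :=
    (norm_exp_sub_one_le_two_mul (hX₀.trans (by norm_num))).trans (by linarith)
  have hE₀' : ‖exp (-Xavg L W q κ) - 1‖ ≤ 1 / 8 :=
    (norm_exp_sub_one_le_two_mul ((norm_neg _).le.trans (hX₀.trans (by norm_num)))).trans
      (by rw [norm_neg]; linarith)
  have hF : ∀ y : Site d, (∀ r : Fin d → Fin L,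
      ‖((tHol W (expCfg A) y (treeWord (boxVec L r)) : 𝔸ˣ) : 𝔸) - 1‖ ≤ 1 / 64) →
      ‖((wframe L W (expCfg A) y : 𝔸ˣ) : 𝔸) - 1‖ ≤ 1 / 16 ∧
        ‖(((wframe L W (expCfg A) y)⁻¹ : 𝔸ˣ) : 𝔸) - 1‖ ≤ 1 / 16 := by
    intro y hy
    have hFy : ‖Fcov L W (expCfg A) y‖ ≤ 1 / 32 :=
      (norm_Fcov_le_of_tHol hL W _ y hy (by norm_num)).trans (by norm_num)
    refine ⟨?_, ?_⟩
    · rw [wframe, val_expUnit]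
      exact (norm_exp_sub_one_le_two_mul (hFy.trans (by norm_num))).trans (by linarith)
    · rw [wframe, val_inv_expUnit, val_expUnit]
      exact (norm_exp_sub_one_le_two_mul ((norm_neg _).le.trans (hFy.trans (by norm_num)))).trans
        (by rw [norm_neg]; linarith)
  -- `Ṽ₁(c) = e^{X'}·t·e^{−X₀}` is within `7/16` of `1`
  have htild : ‖((tild L W (expCfg A) q κ : 𝔸ˣ) : 𝔸) - 1‖ ≤ 7 / 16 := by
    rw [tild_eq_exp_tHol_exp, Units.val_mul, Units.val_mul, val_expUnit, val_expUnit]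
    have h1 := norm_mul_sub_one_le hE' (hτ _ q hseg) (by norm_num)
    refine (norm_mul_sub_one_le h1 hE₀' (by norm_num)).trans ?_
    norm_num
  -- the straight transport `W(Γ_c)` of the complex background: `‖·‖, ‖·⁻¹‖ ≤ (1+u)^L ≤ e^{Lu} ≤ 1 + 1/128`
  have hLu : (1 + u) ^ (seg κ (L : ℤ) : List (Letter d)).length ≤ 129 / 128 := by
    have hs : ((seg κ (L : ℤ) : List (Letter d)).length : ℝ) * u ≤ θ / 2 :=
      (mul_le_mul_of_nonneg_right (by exact_mod_cast hseg) hu).trans hθu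
    have h1 : (1 + u) ^ (seg κ (L : ℤ) : List (Letter d)).length
        ≤ Real.exp (((seg κ (L : ℤ) : List (Letter d)).length : ℝ) * u) := by
      rw [Real.exp_nat_mul]
      exact pow_le_pow_left₀ (by positivity) (by linarith [Real.add_one_le_exp u]) _
    have h2 := exp_sub_one_le_of_le hs (by linarith) (by linarith)
    linarith
  obtain ⟨hhol, hhol'⟩ := norm_hol_le_pow (by positivity : (0 : ℝ) ≤ 1 + u) (norm_bond_cplx_le hV₀ hU)
    (seg κ (L : ℤ)) q
  have hb₀ : ‖((bavg L W q κ : 𝔸ˣ) : 𝔸)‖ ≤ 8 / 7 := by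
    rw [val_bavg]
    refine (norm_mul_le _ _).trans ?_
    have h1 := norm_le_one_add_norm_sub_one (exp (Xavg L W q κ))
    have h2 := hhol.trans hLu
    nlinarith [norm_nonneg (exp (Xavg L W q κ)), norm_nonneg (((hol W q (seg κ (L : ℤ))) : 𝔸ˣ) : 𝔸)]
  have hb₀' : ‖(((bavg L W q κ)⁻¹ : 𝔸ˣ) : 𝔸)‖ ≤ 8 / 7 := by
    have hv : (((bavg L W q κ)⁻¹ : 𝔸ˣ) : 𝔸) = (((hol W q (seg κ L))⁻¹ : 𝔸ˣ) : 𝔸) * exp (-Xavg L W q κ) := by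
      simp only [bavg, mul_inv_rev, val_inv_expUnit, Units.val_mul, val_expUnit]
    rw [hv]
    refine (norm_mul_le _ _).trans ?_
    have h1 := norm_le_one_add_norm_sub_one (exp (-Xavg L W q κ))
    have h2 := hhol'.trans hLu
    nlinarith [norm_nonneg (exp (-Xavg L W q κ)), norm_nonneg ((((hol W q (seg κ (L : ℤ))))⁻¹ : 𝔸ˣ) : 𝔸)]
  -- the rotated frame `R̄_{0,c} w(c₊) = W̄(c)·w(c₊)·W̄(c)⁻¹` is within `1/12` of `1`
  have hZ : ‖((bavg L W q κ : 𝔸ˣ) : 𝔸) * ((wframe L W (expCfg A) (q + (L : ℤ) • e κ) : 𝔸ˣ) : 𝔸)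
      * (((bavg L W q κ)⁻¹ : 𝔸ˣ) : 𝔸) - 1‖ ≤ 1 / 12 := by
    have hw := (hF _ hT₂).1
    refine (norm_units_conj_sub_one_le_mul (bavg L W q κ) _).trans ?_
    have h := mul_le_mul (mul_le_mul hb₀ hw (norm_nonneg _) (by norm_num)) hb₀' (norm_nonneg _) (by norm_num)
    exact h.trans (by norm_num)
  -- assemble (89): `W̿₁(c) = w(c₋)⁻¹ · Ṽ₁(c) · R̄_{0,c} w(c₊)`
  rw [dbavgCov_apply, Units.val_mul, Units.val_mul, Rc_apply, Units.val_mul, Units.val_mul]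
  have h1 := norm_mul_sub_one_le (hF q hT₁).2 htild (by norm_num)
  refine (norm_mul_sub_one_le h1 hZ (by norm_num)).trans ?_
  norm_num

/-- … in particular all five are `< 1`: every contour word entering (89) at the complex background and `W̿₁(c)` itself lie in the
domain of the series logarithm (21). [cite: Balaban1985Averaging, Proposition 7 p.43, (120)–(121) pp.35–36] -/
theorem logDomainCplx_lt {L : ℕ} (hL : 1 ≤ L) {V₀ U'' : Site d → Fin d → 𝔸ˣ} (hV₀ : ∀ x κ, V₀ x κ ∈ U1 𝔸) {u : ℝ} (hu : 0 ≤ u)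
    (hU : ∀ x κ, ‖((U'' x κ : 𝔸ˣ) : 𝔸) - 1‖ ≤ u ∧ ‖(((U'' x κ)⁻¹ : 𝔸ˣ) : 𝔸) - 1‖ ≤ u)
    (A : Site d → Fin d → 𝔸) {a θ α : ℝ} (ha : 0 ≤ a) (hA : ∀ x κ, ‖A x κ‖ ≤ a)
    (hθ : ((2 * (d * L) + L + L : ℕ) : ℝ) * (a + 2 * u) ≤ θ) (hθ0 : 0 ≤ θ) (hθ1 : θ ≤ 1 / 128)
    (q : Site d) (κ : Fin d) (hα1 : α ≤ 1 / 128)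
    (hreg : ∀ r : Fin d → Fin L, ‖((Wcx L V₀ q κ (boxVec L r) : 𝔸ˣ) : 𝔸) - 1‖ ≤ α) :
    (∀ r : Fin d → Fin L, ‖((Wcx L (U'' * V₀) q κ (boxVec L r) : 𝔸ˣ) : 𝔸) - 1‖ < 1) ∧
    (∀ r : Fin d → Fin L, ‖((Wcx L (expCfg A * (U'' * V₀)) q κ (boxVec L r) : 𝔸ˣ) : 𝔸) - 1‖ < 1) ∧
    (∀ r : Fin d → Fin L, ‖((tHol (U'' * V₀) (expCfg A) q (treeWord (boxVec L r)) : 𝔸ˣ) : 𝔸) - 1‖ < 1) ∧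
    (∀ r : Fin d → Fin L,
      ‖((tHol (U'' * V₀) (expCfg A) (q + (L : ℤ) • e κ) (treeWord (boxVec L r)) : 𝔸ˣ) : 𝔸) - 1‖ < 1) ∧
    ‖((dbavgCov L (U'' * V₀) (expCfg A) q κ : 𝔸ˣ) : 𝔸) - 1‖ < 1 := by
  obtain ⟨hWb, hW, hT₁, hT₂, hD⟩ := logDomainCplx hL hV₀ hu hU A ha hA hθ hθ0 hθ1 q κ hα1 hreg
  exact ⟨fun r => (hWb r).trans_lt (by norm_num), fun r => (hW r).trans_lt (by norm_num),
    fun r => (hT₁ r).trans_lt (by norm_num), fun r => (hT₂ r).trans_lt (by norm_num), hD.trans_lt (by norm_num)⟩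

/-- **`Q(W, A, c)` IS BOUNDED ON ITS DOMAIN, UNIFORMLY IN THE PERTURBATION**: `‖log W̿₁(c)‖ ≤ 4` at the complex background
`W = U″V₀` in the regime of `logDomainCplx` (`|log X| ≤ |X − 1|/(1 − |X − 1|)` with `|W̿₁(c) − 1| ≤ 7/10`) — the sup bound the
Cauchy estimates consume. [cite: Balaban1985Averaging, Proposition 7 p.43, (121)–(123) p.36] -/
theorem norm_Qcov_cplx_le {L : ℕ} (hL : 1 ≤ L) {V₀ U'' : Site d → Fin d → 𝔸ˣ} (hV₀ : ∀ x κ, V₀ x κ ∈ U1 𝔸) {u : ℝ} (hu : 0 ≤ u)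
    (hU : ∀ x κ, ‖((U'' x κ : 𝔸ˣ) : 𝔸) - 1‖ ≤ u ∧ ‖(((U'' x κ)⁻¹ : 𝔸ˣ) : 𝔸) - 1‖ ≤ u)
    (A : Site d → Fin d → 𝔸) {a θ α : ℝ} (ha : 0 ≤ a) (hA : ∀ x κ, ‖A x κ‖ ≤ a)
    (hθ : ((2 * (d * L) + L + L : ℕ) : ℝ) * (a + 2 * u) ≤ θ) (hθ0 : 0 ≤ θ) (hθ1 : θ ≤ 1 / 128)
    (q : Site d) (κ : Fin d) (hα1 : α ≤ 1 / 128)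
    (hreg : ∀ r : Fin d → Fin L, ‖((Wcx L V₀ q κ (boxVec L r) : 𝔸ˣ) : 𝔸) - 1‖ ≤ α) :
    ‖Qcov L (U'' * V₀) A q κ‖ ≤ 4 := by
  have hD := (logDomainCplx hL hV₀ hu hU A ha hA hθ hθ0 hθ1 q κ hα1 hreg).2.2.2.2
  rw [Qcov]
  refine (norm_mlog_le_div (hD.trans_lt (by norm_num))).trans ?_
  rw [div_le_iff₀ (by linarith)]
  linarith

end Domain

/-! ## §4 The one-step map at a fixed complex background: analyticity in the field and (123) uniformly in the perturbation -/

section Cauchy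

variable {F : Type*} [NormedAddCommGroup F] [NormedSpace ℂ F] [CompleteSpace F]

/-- **Second-order Cauchy estimate at the centre of a disc**: `g` complex-differentiable on the closed disc `|t| ≤ R`,
`g 0 = 0`, `‖g‖ ≤ M` on the circle `|t| = R` ⟹ `‖g t − t·g′(0)‖ ≤ (2M/R²)·|t|²` for `|t| ≤ R`.  (`private` generic helper — a
verbatim twin of the private helper of `B7Eq123General` §1, which is not exported.) [folklore] -/
private theorem norm_sub_smul_deriv_le_of_sphere {g : ℂ → F} {R M : ℝ} (hR : 0 < R)
    (hg : DifferentiableOn ℂ g (closedBall 0 R)) (hM : ∀ z ∈ sphere (0 : ℂ) R, ‖g z‖ ≤ M) (h0 : g 0 = 0)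
    {t : ℂ} (ht : ‖t‖ ≤ R) : ‖g t - t • deriv g 0‖ ≤ 2 * M / R ^ 2 * ‖t‖ ^ 2 := by
  have hcl : closure (ball (0 : ℂ) R) = closedBall 0 R := closure_ball 0 hR.ne'
  have hfr : frontier (ball (0 : ℂ) R) = sphere 0 R := frontier_ball 0 hR.ne'
  have hnhds : closedBall (0 : ℂ) R ∈ nhds (0 : ℂ) := closedBall_mem_nhds 0 hR
  set φ : ℂ → F := dslope g 0 with hφ
  set ψ : ℂ → F := dslope φ 0 with hψ
  have hφd : DifferentiableOn ℂ φ (closedBall 0 R) := (Complex.differentiableOn_dslope hnhds).2 hg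
  have hψd : DifferentiableOn ℂ ψ (closedBall 0 R) := (Complex.differentiableOn_dslope hnhds).2 hφd
  have hφ_eq : ∀ s : ℂ, s • φ s = g s := fun s => by
    have := sub_smul_dslope g 0 s
    rwa [sub_zero, h0, sub_zero] at this
  have hψ_eq : ∀ s : ℂ, s • ψ s = φ s - deriv g 0 := fun s => by
    have := sub_smul_dslope φ 0 s
    rwa [sub_zero, hφ, dslope_same] at this
  have hgc : DiffContOnCl ℂ g (ball 0 R) := DifferentiableOn.diffContOnCl (by rw [hcl]; exact hg)
  have hψc : DiffContOnCl ℂ ψ (ball 0 R) := DifferentiableOn.diffContOnCl (by rw [hcl]; exact hψd)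
  have hg' : ‖deriv g 0‖ ≤ M / R := Complex.norm_deriv_le_of_forall_mem_sphere_norm_le hR hgc hM
  have hψS : ∀ z ∈ sphere (0 : ℂ) R, ‖ψ z‖ ≤ 2 * M / R ^ 2 := by
    intro z hz
    have hzR : ‖z‖ = R := mem_sphere_zero_iff_norm.1 hz
    have h2 : R * ‖ψ z‖ ≤ M / R + M / R := by
      have h1 : R * ‖φ z‖ ≤ M := by
        have := congrArg (‖·‖) (hφ_eq z)
        simp only [norm_smul, hzR] at this
        rw [this]; exact hM z hz
      have := congrArg (‖·‖) (hψ_eq z)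
      simp only [norm_smul, hzR] at this
      rw [this]
      refine (norm_sub_le _ _).trans (add_le_add ?_ hg')
      rw [le_div_iff₀ hR]; linarith
    rw [le_div_iff₀ (by positivity)]
    have : R * (R * ‖ψ z‖) ≤ R * (M / R + M / R) := mul_le_mul_of_nonneg_left h2 hR.le
    have hRR : R * (M / R + M / R) = 2 * M := by field_simp; ring
    nlinarith
  have hψt : ‖ψ t‖ ≤ 2 * M / R ^ 2 :=
    Complex.norm_le_of_forall_mem_frontier_norm_le isBounded_ball hψc (by rw [hfr]; exact hψS)
      (by rw [hcl]; exact mem_closedBall_zero_iff.2 ht)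
  have hrem : g t - t • deriv g 0 = t • (t • ψ t) := by
    rw [hψ_eq t, smul_sub, hφ_eq t]
  rw [hrem, norm_smul, norm_smul]
  have ht0 : 0 ≤ ‖t‖ := norm_nonneg t
  calc ‖t‖ * (‖t‖ * ‖ψ t‖) ≤ ‖t‖ * (‖t‖ * (2 * M / R ^ 2)) := by gcongr
    _ = 2 * M / R ^ 2 * ‖t‖ ^ 2 := by ring

/-- **first-order Cauchy estimate at the centre of a disc** (`‖g′(0)‖ ≤ M/R`) and the resulting linear growth `‖g t‖ ≤ 3M|t|/R` for
`g 0 = 0` — generic helper (`private`). [folklore] -/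
private theorem norm_le_linear_of_sphere {g : ℂ → F} {R M : ℝ} (hR : 0 < R)
    (hg : DifferentiableOn ℂ g (closedBall 0 R)) (hM : ∀ z ∈ sphere (0 : ℂ) R, ‖g z‖ ≤ M) (h0 : g 0 = 0)
    {t : ℂ} (ht : ‖t‖ ≤ R) : ‖deriv g 0‖ ≤ M / R ∧ ‖g t‖ ≤ 3 * M / R * ‖t‖ := by
  have hcl : closure (ball (0 : ℂ) R) = closedBall 0 R := closure_ball 0 hR.ne'
  have hgc : DiffContOnCl ℂ g (ball 0 R) := DifferentiableOn.diffContOnCl (by rw [hcl]; exact hg)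
  have hg' : ‖deriv g 0‖ ≤ M / R := Complex.norm_deriv_le_of_forall_mem_sphere_norm_le hR hgc hM
  refine ⟨hg', ?_⟩
  have hM0 : 0 ≤ M := by
    obtain ⟨z, hz⟩ : ∃ z : ℂ, z ∈ sphere (0 : ℂ) R := ⟨(R : ℂ), by simp [abs_of_pos hR]⟩
    exact (norm_nonneg _).trans (hM z hz)
  have h2 := norm_sub_smul_deriv_le_of_sphere hR hg hM h0 ht
  have ht0 : 0 ≤ ‖t‖ := norm_nonneg t
  have htR : ‖t‖ / R ≤ 1 := by rw [div_le_one hR]; exact ht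
  calc ‖g t‖ = ‖(g t - t • deriv g 0) + t • deriv g 0‖ := by rw [sub_add_cancel]
    _ ≤ ‖g t - t • deriv g 0‖ + ‖t • deriv g 0‖ := norm_add_le _ _
    _ ≤ 2 * M / R ^ 2 * ‖t‖ ^ 2 + ‖t‖ * (M / R) := by rw [norm_smul]; gcongr
    _ = (2 * (‖t‖ / R) + 1) * (M / R) * ‖t‖ := by field_simp
    _ ≤ (2 * 1 + 1) * (M / R) * ‖t‖ := by gcongr
    _ = 3 * M / R * ‖t‖ := by ring

end Cauchy

section OneStepFixed

variable {𝔸 : Type*} [NormedRing 𝔸] [NormedAlgebra ℂ 𝔸] [CompleteSpace 𝔸] [NormOneClass 𝔸]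
variable {E : Type*} [NormedAddCommGroup E] [NormedSpace ℂ E]

/-- **«Proposition 3 holds … for V′V₀ instead of V₀», THE ANALYTICITY CLAUSE IN THE FIELD**: at a fixed complex background `W = U″V₀`
of the §3 regime, `t ↦ Q(W, B(t), c) = log W̿₁(c)[e^{B(t)}]` is analytic at `t₀` for every bondwise-analytic family `B(t)` with
`(2d+2)L·(sup|B(t₀)_b| + 2u) ≤ θ ≤ 1/128` (`B7Prop3GeneralAnalytic.analyticAt_mlog_dbavgCov_expCfg` is stated for an ARBITRARY
background; the domain conditions are `logDomainCplx_lt`). [cite: Balaban1985Averaging, Proposition 7 p.43, Proposition 3 (121) p.36] -/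
theorem Qcov_cplx_analyticAt_field (B : E → Site d → Fin d → 𝔸) {t₀ : E}
    (hB : ∀ x κ, AnalyticAt ℂ (fun t => B t x κ) t₀) {L : ℕ} (hL : 1 ≤ L)
    {V₀ U'' : Site d → Fin d → 𝔸ˣ} (hV₀ : ∀ x κ, V₀ x κ ∈ U1 𝔸) {u : ℝ} (hu : 0 ≤ u)
    (hU : ∀ x κ, ‖((U'' x κ : 𝔸ˣ) : 𝔸) - 1‖ ≤ u ∧ ‖(((U'' x κ)⁻¹ : 𝔸ˣ) : 𝔸) - 1‖ ≤ u)
    {a θ α : ℝ} (ha : 0 ≤ a) (hA : ∀ x κ, ‖B t₀ x κ‖ ≤ a)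
    (hθ : ((2 * (d * L) + L + L : ℕ) : ℝ) * (a + 2 * u) ≤ θ) (hθ0 : 0 ≤ θ) (hθ1 : θ ≤ 1 / 128)
    (q : Site d) (κ : Fin d) (hα1 : α ≤ 1 / 128)
    (hreg : ∀ r : Fin d → Fin L, ‖((Wcx L V₀ q κ (boxVec L r) : 𝔸ˣ) : 𝔸) - 1‖ ≤ α) :
    AnalyticAt ℂ (fun t => Qcov L (U'' * V₀) (B t) q κ) t₀ := by
  obtain ⟨-, hW, hT₁, hT₂, hD⟩ := logDomainCplx_lt hL hV₀ hu hU (B t₀) ha hA hθ hθ0 hθ1 q κ hα1 hreg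
  unfold Qcov
  exact analyticAt_mlog_dbavgCov_expCfg B hB L (U'' * V₀) q κ hW hT₁ hT₂ hD

/-- print's thresholds in the `θ`-currency: `a ≤ c₃(d, L)/4 = 1/(512(d+1)L)` and `(2d+2)L·u ≤ 1/512` give `(2d+2)L·(a + 2u) ≤ 1/128`
(private arithmetic helper). [cite: Balaban1985Averaging, Proposition 7 p.43] -/
private theorem theta_le_cplx {L : ℕ} (hL : 1 ≤ L) {a u : ℝ} (hac : a ≤ c3 d L / 4)
    (hun : ((2 * (d * L) + L + L : ℕ) : ℝ) * u ≤ 1 / 512) :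
    ((2 * (d * L) + L + L : ℕ) : ℝ) * (a + 2 * u) ≤ 1 / 128 := by
  have hL1 : (1 : ℝ) ≤ L := by exact_mod_cast hL
  have hcast : ((2 * (d * L) + L + L : ℕ) : ℝ) = 2 * ((d : ℝ) + 1) * L := by push_cast; ring
  rw [hcast] at hun ⊢
  have hpos : (0 : ℝ) < 128 * ((d : ℝ) + 1) * L := by positivity
  have h1 : a * (128 * ((d : ℝ) + 1) * L) ≤ 1 / 4 := by
    have := mul_le_mul_of_nonneg_right hac hpos.le
    rw [c3, one_div] at this
    have hh : (128 * ((d : ℝ) + 1) * ↑L)⁻¹ / 4 * (128 * ((d : ℝ) + 1) * ↑L) = 1 / 4 := by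
      field_simp
    linarith [hh]
  nlinarith

/-- **«PROPOSITION 3 HOLDS UNIFORMLY FOR V′V₀ INSTEAD OF V₀» — THE SECOND-ORDER REMAINDER (123) AT THE COMPLEX BACKGROUND,
WITH A CONSTANT INDEPENDENT OF THE PERTURBATION**: for `V₀` unit-bounded with block loops at `c = (q, κ)` within `α ≤ 1/128` of `1`,
any unit-valued `U″` within `u` of `1` bondwise with `(2d+2)L·u ≤ 1/512`, and `sup_b|A_b| ≤ a ≤ c₃(d,L)/4`:
`‖C(U″V₀, A, c)‖ ≤ (8/(c₃/4)²)·a²`.  Route = p06's for `B7Eq123General.norm_Ccov_le` (print's «analytic … Taylor's expansion begins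
with a second-order polynomial»): the ray `t ↦ Q(U″V₀, tA, c)` vanishes at `0`, is analytic with `|·| ≤ 4` on `|t| ≤ (c₃/4)/a`
(`Qcov_cplx_analyticAt_field`, `norm_Qcov_cplx_le`), and the Cauchy estimate at `t = 1`. [cite: Balaban1985Averaging, Proposition 7 p.43, Proposition 3 (123) p.36] -/
theorem norm_Ccov_cplx_le {L : ℕ} (hL : 1 ≤ L) {V₀ U'' : Site d → Fin d → 𝔸ˣ} (hV₀ : ∀ x κ, V₀ x κ ∈ U1 𝔸) {u : ℝ}
    (hu : 0 ≤ u) (hU : ∀ x κ, ‖((U'' x κ : 𝔸ˣ) : 𝔸) - 1‖ ≤ u ∧ ‖(((U'' x κ)⁻¹ : 𝔸ˣ) : 𝔸) - 1‖ ≤ u)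
    (hun : ((2 * (d * L) + L + L : ℕ) : ℝ) * u ≤ 1 / 512)
    (A : Site d → Fin d → 𝔸) {a α : ℝ} (ha : 0 ≤ a) (hA : ∀ x κ, ‖A x κ‖ ≤ a) (hac : a ≤ c3 d L / 4)
    (q : Site d) (κ : Fin d) (hα1 : α ≤ 1 / 128)
    (hreg : ∀ r : Fin d → Fin L, ‖((Wcx L V₀ q κ (boxVec L r) : 𝔸ˣ) : 𝔸) - 1‖ ≤ α) :
    ‖Ccov L (U'' * V₀) A q κ‖ ≤ 8 / (c3 d L / 4) ^ 2 * a ^ 2 := by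
  rcases ha.eq_or_lt with h0 | hpos
  · -- the degenerate field `A = 0`
    have hA0 : A = 0 := by
      funext x κ'
      have := hA x κ'
      rw [← h0] at this
      exact norm_le_zero_iff.1 this
    subst hA0
    have hlin : linQcov L (U'' * V₀) (0 : Site d → Fin d → 𝔸) q κ = 0 := by
      simp only [linQcov, smul_zero, Qcov_zero, deriv_const]
    rw [Ccov, Qcov_zero, hlin, sub_zero, norm_zero]
    positivity
  -- the ray function and the radius `R = (c₃/4)/a ≥ 1`
  set g : ℂ → 𝔸 := fun t : ℂ => Qcov L (U'' * V₀) (t • A) q κ with hg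
  set R : ℝ := c3 d L / 4 / a with hR
  have hR1 : 1 ≤ R := by rw [hR, le_div_iff₀ hpos]; linarith
  have hR0 : 0 < R := by linarith
  have hdisc : ∀ t : ℂ, ‖t‖ ≤ R → ‖t‖ * a ≤ c3 d L / 4 := fun t ht => by
    rw [hR, le_div_iff₀ hpos] at ht; exact ht
  have htA : ∀ t : ℂ, ∀ x κ', ‖(t • A) x κ'‖ ≤ ‖t‖ * a := fun t x κ' => by
    rw [Pi.smul_apply, Pi.smul_apply, norm_smul]; exact mul_le_mul_of_nonneg_left (hA x κ') (norm_nonneg _)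
  -- analytic on the closed disc
  have hDiff : DifferentiableOn ℂ g (closedBall 0 R) := fun t ht => by
    have han : AnalyticAt ℂ g t :=
      Qcov_cplx_analyticAt_field (fun t : ℂ => t • A)
        (fun x κ' => by simp only [Pi.smul_apply]; exact analyticAt_id.smul analyticAt_const)
        hL hV₀ hu hU (by positivity) (htA t) (θ := 1 / 128)
        (theta_le_cplx hL (hdisc t (mem_closedBall_zero_iff.1 ht)) hun) (by norm_num) le_rfl q κ hα1 hreg
    exact han.differentiableAt.differentiableWithinAt
  -- bounded by `4` on the circle
  have hM : ∀ t ∈ sphere (0 : ℂ) R, ‖g t‖ ≤ 4 := fun t ht =>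
    norm_Qcov_cplx_le hL hV₀ hu hU (t • A) (a := ‖t‖ * a) (by positivity) (htA t) (θ := 1 / 128)
      (theta_le_cplx hL (hdisc t (mem_sphere_zero_iff_norm.1 ht).le) hun) (by norm_num) le_rfl q κ hα1 hreg
  -- vanishes at the centre
  have h0 : g 0 = 0 := by simp only [hg, zero_smul]; exact Qcov_zero L _ q κ
  -- the Cauchy estimate at `t = 1`
  have h := norm_sub_smul_deriv_le_of_sphere hR0 hDiff hM h0 (t := 1) (by rw [norm_one]; exact hR1)
  rw [norm_one, one_pow, mul_one, one_smul] at h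
  have hg1 : g 1 = Qcov L (U'' * V₀) A q κ := by simp only [hg, one_smul]
  have hgd : deriv g 0 = linQcov L (U'' * V₀) A q κ := rfl
  rw [hg1, hgd] at h
  rw [Ccov]
  refine h.trans (le_of_eq ?_)
  have ha' : a ≠ 0 := hpos.ne'
  have hc : c3 d L ≠ 0 := (c3_pos d hL).ne'
  rw [hR, div_pow, div_pow]
  field_simp
  ring

/-- the constant made explicit: `8/(c₃(d,L)/4)² = 2097152·(d+1)²·L²` — «C₁L²» of (123) becomes `16·C₁L²` (`C₁ = 131072(d+1)²` of
`B7Eq123General.norm_Ccov_le_explicit`) at the complex background, still depending on `d` only — print's «the same results as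
before for α₀, α₁ sufficiently small, uniformly in A′». [cite: Balaban1985Averaging, Proposition 7 p.43, Proposition 3 (123) p.36] -/
theorem norm_Ccov_cplx_le_explicit {L : ℕ} (hL : 1 ≤ L) {V₀ U'' : Site d → Fin d → 𝔸ˣ} (hV₀ : ∀ x κ, V₀ x κ ∈ U1 𝔸) {u : ℝ}
    (hu : 0 ≤ u) (hU : ∀ x κ, ‖((U'' x κ : 𝔸ˣ) : 𝔸) - 1‖ ≤ u ∧ ‖(((U'' x κ)⁻¹ : 𝔸ˣ) : 𝔸) - 1‖ ≤ u)
    (hun : ((2 * (d * L) + L + L : ℕ) : ℝ) * u ≤ 1 / 512)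
    (A : Site d → Fin d → 𝔸) {a α : ℝ} (ha : 0 ≤ a) (hA : ∀ x κ, ‖A x κ‖ ≤ a) (hac : a ≤ c3 d L / 4)
    (q : Site d) (κ : Fin d) (hα1 : α ≤ 1 / 128)
    (hreg : ∀ r : Fin d → Fin L, ‖((Wcx L V₀ q κ (boxVec L r) : 𝔸ˣ) : 𝔸) - 1‖ ≤ α) :
    ‖Ccov L (U'' * V₀) A q κ‖ ≤ 2097152 * ((d : ℝ) + 1) ^ 2 * (L : ℝ) ^ 2 * a ^ 2 := by
  refine (norm_Ccov_cplx_le hL hV₀ hu hU hun A ha hA hac q κ hα1 hreg).trans (le_of_eq ?_)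
  have hL0 : (0 : ℝ) < L := by exact_mod_cast hL
  have hpos : (0 : ℝ) < 128 * ((d : ℝ) + 1) * L := by positivity
  rw [c3]
  field_simp
  ring

/-- **(123) at the complex background in plaquette currency**: `V₀` unit-bounded with `pdev V₀ < β ≤ 1/(2048(d+1)(d+4)L²)`
(«|V₀(∂p) − 1| < α₀», (109), via Prop. 1 / `B7Eq123General.blockLoops_of_pdev`), `U″` as above, `sup_b|A_b| ≤ a ≤ c₃(d,L)/4` ⟹
`‖C(U″V₀, A, c)‖ ≤ 2097152(d+1)²L²·a²` at EVERY `L`-bond `c`. [cite: Balaban1985Averaging, Proposition 7 p.43, Proposition 3 (123) p.36, (109) p.34] -/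
theorem norm_Ccov_cplx_le_of_pdev {L : ℕ} (hL : 1 ≤ L) {V₀ U'' : Site d → Fin d → 𝔸ˣ} (hV₀ : ∀ x κ, V₀ x κ ∈ U1 𝔸)
    {β : ℝ} (hβ0 : 0 ≤ β) (hβ : pdev V₀ < β) (hβmax : β ≤ 1 / (2048 * ((d : ℝ) + 1) * ((d : ℝ) + 4) * (L : ℝ) ^ 2))
    {u : ℝ} (hu : 0 ≤ u) (hU : ∀ x κ, ‖((U'' x κ : 𝔸ˣ) : 𝔸) - 1‖ ≤ u ∧ ‖(((U'' x κ)⁻¹ : 𝔸ˣ) : 𝔸) - 1‖ ≤ u)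
    (hun : ((2 * (d * L) + L + L : ℕ) : ℝ) * u ≤ 1 / 512)
    (A : Site d → Fin d → 𝔸) {a : ℝ} (ha : 0 ≤ a) (hA : ∀ x κ, ‖A x κ‖ ≤ a) (hac : a ≤ c3 d L / 4)
    (q : Site d) (κ : Fin d) :
    ‖Ccov L (U'' * V₀) A q κ‖ ≤ 2097152 * ((d : ℝ) + 1) ^ 2 * (L : ℝ) ^ 2 * a ^ 2 := by
  have hL0 : (0 : ℝ) < L := by exact_mod_cast hL
  have hX : (0 : ℝ) < 2048 * ((d : ℝ) + 1) * ((d : ℝ) + 4) * (L : ℝ) ^ 2 := by positivity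
  have hβmax' : β ≤ 1 / (1024 * ((d : ℝ) + 1) * ((d : ℝ) + 4) * (L : ℝ) ^ 2) :=
    hβmax.trans (by gcongr; norm_num)
  obtain ⟨hreg, -⟩ := blockLoops_of_pdev hL hV₀ hβ0 hβ hβmax' q κ
  have hXβ : 2048 * ((d : ℝ) + 1) * ((d : ℝ) + 4) * (L : ℝ) ^ 2 * β ≤ 1 := by
    have := mul_le_mul_of_nonneg_left hβmax hX.le
    rwa [one_div, mul_inv_cancel₀ hX.ne'] at this
  exact norm_Ccov_cplx_le_explicit hL hV₀ hu hU hun A ha hA hac q κ (α := 16 * ((d : ℝ) + 1) * ((d : ℝ) + 4) * (L : ℝ) ^ 2 * β)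
    (by nlinarith) hreg

/-- **CRUDE FIRST-ORDER BOUNDS AT THE COMPLEX BACKGROUND, UNIFORM IN THE PERTURBATION** (Cauchy, not print's (124)–(126)): in the regime
of `norm_Ccov_cplx_le`, `‖L(Q(U″V₀)A)_c‖ ≤ (16/c₃(d,L))·a = 2048(d+1)L·a` and `‖Q(U″V₀, A, c)‖ ≤ (48/c₃(d,L))·a = 6144(d+1)L·a`.  These are
`d·L`-dependent witnesses for print's «|Q(V₀)A| ≤ (1 + O(1)(L²α₀ + Lα₁))|A|» (whose sharp form — leading coefficient `L·1` in this
un-normalised currency — is the complex-background rewrite of `B7Prop3GeneralLinearBound`, the sequel's); they already give SOME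
polydisc of joint analyticity for every `k`. [cite: Balaban1985Averaging, Proposition 7 p.43, (126) p.36, (131) p.38] -/
theorem norm_linQcov_cplx_le_crude {L : ℕ} (hL : 1 ≤ L) {V₀ U'' : Site d → Fin d → 𝔸ˣ} (hV₀ : ∀ x κ, V₀ x κ ∈ U1 𝔸) {u : ℝ}
    (hu : 0 ≤ u) (hU : ∀ x κ, ‖((U'' x κ : 𝔸ˣ) : 𝔸) - 1‖ ≤ u ∧ ‖(((U'' x κ)⁻¹ : 𝔸ˣ) : 𝔸) - 1‖ ≤ u)
    (hun : ((2 * (d * L) + L + L : ℕ) : ℝ) * u ≤ 1 / 512)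
    (A : Site d → Fin d → 𝔸) {a α : ℝ} (ha : 0 ≤ a) (hA : ∀ x κ, ‖A x κ‖ ≤ a) (hac : a ≤ c3 d L / 4)
    (q : Site d) (κ : Fin d) (hα1 : α ≤ 1 / 128)
    (hreg : ∀ r : Fin d → Fin L, ‖((Wcx L V₀ q κ (boxVec L r) : 𝔸ˣ) : 𝔸) - 1‖ ≤ α) :
    ‖linQcov L (U'' * V₀) A q κ‖ ≤ 16 / c3 d L * a ∧ ‖Qcov L (U'' * V₀) A q κ‖ ≤ 48 / c3 d L * a := by
  rcases ha.eq_or_lt with h0 | hpos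
  · have hA0 : A = 0 := by
      funext x κ'
      have := hA x κ'
      rw [← h0] at this
      exact norm_le_zero_iff.1 this
    subst hA0
    have hlin : linQcov L (U'' * V₀) (0 : Site d → Fin d → 𝔸) q κ = 0 := by
      simp only [linQcov, smul_zero, Qcov_zero, deriv_const]
    rw [hlin, Qcov_zero, norm_zero, ← h0, mul_zero, mul_zero]
    exact ⟨le_rfl, le_rfl⟩
  set g : ℂ → 𝔸 := fun t : ℂ => Qcov L (U'' * V₀) (t • A) q κ with hg
  set R : ℝ := c3 d L / 4 / a with hR
  have hR1 : 1 ≤ R := by rw [hR, le_div_iff₀ hpos]; linarith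
  have hR0 : 0 < R := by linarith
  have hdisc : ∀ t : ℂ, ‖t‖ ≤ R → ‖t‖ * a ≤ c3 d L / 4 := fun t ht => by
    rw [hR, le_div_iff₀ hpos] at ht; exact ht
  have htA : ∀ t : ℂ, ∀ x κ', ‖(t • A) x κ'‖ ≤ ‖t‖ * a := fun t x κ' => by
    rw [Pi.smul_apply, Pi.smul_apply, norm_smul]; exact mul_le_mul_of_nonneg_left (hA x κ') (norm_nonneg _)
  have hDiff : DifferentiableOn ℂ g (closedBall 0 R) := fun t ht => by
    have han : AnalyticAt ℂ g t :=
      Qcov_cplx_analyticAt_field (fun t : ℂ => t • A)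
        (fun x κ' => by simp only [Pi.smul_apply]; exact analyticAt_id.smul analyticAt_const)
        hL hV₀ hu hU (by positivity) (htA t) (θ := 1 / 128)
        (theta_le_cplx hL (hdisc t (mem_closedBall_zero_iff.1 ht)) hun) (by norm_num) le_rfl q κ hα1 hreg
    exact han.differentiableAt.differentiableWithinAt
  have hM : ∀ t ∈ sphere (0 : ℂ) R, ‖g t‖ ≤ 4 := fun t ht =>
    norm_Qcov_cplx_le hL hV₀ hu hU (t • A) (a := ‖t‖ * a) (by positivity) (htA t) (θ := 1 / 128)
      (theta_le_cplx hL (hdisc t (mem_sphere_zero_iff_norm.1 ht).le) hun) (by norm_num) le_rfl q κ hα1 hreg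
  have h0 : g 0 = 0 := by simp only [hg, zero_smul]; exact Qcov_zero L _ q κ
  obtain ⟨h1, h2⟩ := norm_le_linear_of_sphere hR0 hDiff hM h0 (t := 1) (by rw [norm_one]; exact hR1)
  have hg1 : g 1 = Qcov L (U'' * V₀) A q κ := by simp only [hg, one_smul]
  have hgd : deriv g 0 = linQcov L (U'' * V₀) A q κ := rfl
  rw [hgd] at h1
  rw [hg1, norm_one, mul_one] at h2
  have ha' : a ≠ 0 := hpos.ne'
  have hc : 0 < c3 d L := c3_pos d hL
  refine ⟨h1.trans (le_of_eq ?_), h2.trans (le_of_eq ?_)⟩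
  · rw [hR]; field_simp; ring
  · rw [hR]; field_simp; ring

/-- the crude constants made explicit: `16/c₃(d,L) = 2048(d+1)L`, `48/c₃(d,L) = 6144(d+1)L`. [cite: Balaban1985Averaging, Proposition 7 p.43, (131) p.38] -/
theorem norm_Qcov_cplx_le_crude_explicit {L : ℕ} (hL : 1 ≤ L) {V₀ U'' : Site d → Fin d → 𝔸ˣ} (hV₀ : ∀ x κ, V₀ x κ ∈ U1 𝔸) {u : ℝ}
    (hu : 0 ≤ u) (hU : ∀ x κ, ‖((U'' x κ : 𝔸ˣ) : 𝔸) - 1‖ ≤ u ∧ ‖(((U'' x κ)⁻¹ : 𝔸ˣ) : 𝔸) - 1‖ ≤ u)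
    (hun : ((2 * (d * L) + L + L : ℕ) : ℝ) * u ≤ 1 / 512)
    (A : Site d → Fin d → 𝔸) {a α : ℝ} (ha : 0 ≤ a) (hA : ∀ x κ, ‖A x κ‖ ≤ a) (hac : a ≤ c3 d L / 4)
    (q : Site d) (κ : Fin d) (hα1 : α ≤ 1 / 128)
    (hreg : ∀ r : Fin d → Fin L, ‖((Wcx L V₀ q κ (boxVec L r) : 𝔸ˣ) : 𝔸) - 1‖ ≤ α) :
    ‖linQcov L (U'' * V₀) A q κ‖ ≤ 2048 * ((d : ℝ) + 1) * L * a ∧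
      ‖Qcov L (U'' * V₀) A q κ‖ ≤ 6144 * ((d : ℝ) + 1) * L * a := by
  obtain ⟨h1, h2⟩ := norm_linQcov_cplx_le_crude hL hV₀ hu hU hun A ha hA hac q κ hα1 hreg
  have hL0 : (0 : ℝ) < L := by exact_mod_cast hL
  have hpos : (0 : ℝ) < 128 * ((d : ℝ) + 1) * L := by positivity
  have e1 : 16 / c3 d L = 2048 * ((d : ℝ) + 1) * L := by rw [c3]; field_simp; ring
  have e2 : 48 / c3 d L = 6144 * ((d : ℝ) + 1) * L := by rw [c3]; field_simp; ring
  exact ⟨e1 ▸ h1, e2 ▸ h2⟩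

end OneStepFixed

end Literature.MathematicalPhysics.QuantumFieldTheory.Balaban1983to89.B7Prop7OneStep

end
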